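import Mathlib
import Summits.Parity.GeneralizedHardyLittlewood.Theses.LiouvilleShiftedTables
import Summits.Parity.GeneralizedHardyLittlewood.Theorems.LiouvilleShiftedTablesTableChowlaStubInversePrimeCols

/-!
# `stub_residual_primeCore` — under the residual `MeanSquareCM`, the prime-column bilinear form of the
# shifted multiplication table `λ(ab+c)` is small (r4 calibration T2)

Crux `LiouvilleShiftedTables.TableChowla` (stmt-Parity-14270), line `helson-kronecker-inverse`, lead
reshape r4. The line splits the crux as `InverseCM ∧ MeanSquareCM`. `MeanSquareCM` (the hypothesis of
the theorem below, verbatim the statement of the open stub `stub_residualCM`) bounds the mean square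
`∑_a ‖∑_{b ≤ y} g(b) λ(ab+c)‖²` of the table against EVERY completely multiplicative 1-bounded column
weight `g` by `x(x/A)/(log x)^C`, for every `C`. The landed calibration T1 `stub_inverse_primeCols` says:
if the bilinear form restricted to the LARGE PRIME columns (`p` prime, `p² > ⌊x/A⌋`) is at least
`√x/(log x)^C` on some `ℓ²`-unit pair `(u, v)`, then some completely multiplicative 1-bounded `g` and
`y ≤ x/A` have mean square at least `x(x/A)/(log x)^{C'}`.

T2 (this file) combines the two: under `MeanSquareCM` the prime-column form is at most `√x/(log x)^C`
for every `C` and every `ℓ²`-unit pair — i.e. the residual already contains arbitrary-coefficient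
Type II information for `λ(ap+c)` on rows × large prime columns. The proof is pure logic plus
`(log x)^{C'} < (log x)^{C'+1}` for `x ≥ 3 > e`, exactly as in `operatorNormForm_of_inverse_msed` of the
line file.
-/

namespace Summit.Parity.GeneralizedHardyLittlewood.Theorems.TableChowla.HelsonKroneckerInverse

open Finset Real ArithmeticFunction

/-- CALIBRATION T2. If the residual `MeanSquareCM` holds (the mean square of the shifted table
`λ(ab+c)` against every completely multiplicative 1-bounded column weight `g` and every column length
`y ≤ x/A` is `≤ x(x/A)/(log x)^C` for every `C > 0`, eventually in `x`, uniformly over the window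
`x^δ ≤ A ≤ x^{1/3+δ}`), then for every `c ≠ 0`, `0 < δ ≤ 1/12`, `C > 0`, eventually in `x`, the bilinear
form of `λ(ab+c)` on rows `a ∈ (⌊A⌋, ⌊2A⌋]` and LARGE PRIME columns `b = p ≤ ⌊x/A⌋`, `p² > ⌊x/A⌋`, is
at most `√x/(log x)^C` on every `ℓ²`-unit pair `(u, v)`. Combine with T1 `stub_inverse_primeCols` at
the exponent `C' + 1`. -/
theorem stub_residual_primeCore :
    (∀ c : ℤ, c ≠ 0 → ∀ δ : ℝ, 0 < δ → δ ≤ 1 / 12 → ∀ C : ℝ, 0 < C → ∃ x₀ : ℝ, ∀ x : ℝ, x₀ ≤ x →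
      ∀ A : ℝ, x ^ δ ≤ A → A ≤ x ^ (1 / 3 + δ) →
      ∀ g : ℕ → ℂ, (∀ m n : ℕ, g (m * n) = g m * g n) → (∀ n : ℕ, ‖g n‖ ≤ 1) →
      ∀ y : ℝ, y ≤ x / A →
        ∑ a ∈ Finset.Ioc ⌊A⌋₊ ⌊2 * A⌋₊,
            ‖∑ b ∈ Finset.Icc 1 ⌊y⌋₊, g b *
              ((ArithmeticFunction.liouville (Int.toNat ((a : ℤ) * b + c)) : ℝ) : ℂ)‖ ^ 2 ≤
          x * (x / A) / Real.log x ^ C) →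
    ∀ c : ℤ, c ≠ 0 → ∀ δ : ℝ, 0 < δ → δ ≤ 1 / 12 → ∀ C : ℝ, 0 < C → ∃ x₀ : ℝ, ∀ x : ℝ, x₀ ≤ x →
      ∀ A : ℝ, x ^ δ ≤ A → A ≤ x ^ (1 / 3 + δ) →
      ∀ u v : ℕ → ℝ, (∑ a ∈ Finset.Ioc ⌊A⌋₊ ⌊2 * A⌋₊, u a ^ 2 ≤ 1) →
        (∑ b ∈ Finset.Icc 1 ⌊x / A⌋₊, v b ^ 2 ≤ 1) →
        |∑ a ∈ Finset.Ioc ⌊A⌋₊ ⌊2 * A⌋₊,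
            ∑ b ∈ (Finset.Icc 1 ⌊x / A⌋₊).filter (fun b => b.Prime ∧ ⌊x / A⌋₊ < b * b),
              u a * v b * (ArithmeticFunction.liouville (Int.toNat ((a : ℤ) * b + c)) : ℝ)| ≤
          x ^ (1 / 2 : ℝ) / Real.log x ^ C := by
  intro hMS c hc δ hδ hδ' C hC
  obtain ⟨C', hC', x₁, h1⟩ := stub_inverse_primeCols c δ hδ hδ' C hC
  obtain ⟨x₂, h2⟩ := hMS c hc δ hδ hδ' (C' + 1) (by linarith)
  refine ⟨max (max x₁ x₂) 3, ?_⟩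
  intro x hx A hA hA' u v hu hv
  have hx₁ : x₁ ≤ x := le_trans (le_trans (le_max_left _ _) (le_max_left _ _)) hx
  have hx₂ : x₂ ≤ x := le_trans (le_trans (le_max_right _ _) (le_max_left _ _)) hx
  have hx3 : (3 : ℝ) ≤ x := le_trans (le_max_right _ _) hx
  by_contra hlt
  push Not at hlt
  obtain ⟨g, hgm, hgb, y, hy, hbig⟩ := h1 x hx₁ A hA hA' u v hu hv hlt.le
  have hsmall := h2 x hx₂ A hA hA' g hgm hgb y hy
  have hxpos : 0 < x := by linarith
  have hApos : 0 < A := lt_of_lt_of_le (Real.rpow_pos_of_pos hxpos δ) hA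
  have hnum : 0 < x * (x / A) := mul_pos hxpos (div_pos hxpos hApos)
  have hlog : 1 < Real.log x := by
    have he : Real.exp 1 < x :=
      lt_of_lt_of_le (lt_trans Real.exp_one_lt_d9 (by norm_num)) hx3
    exact (Real.lt_log_iff_exp_lt hxpos).2 he
  have hLpos : 0 < Real.log x := by linarith
  have hpow : Real.log x ^ C' < Real.log x ^ (C' + 1) :=
    Real.rpow_lt_rpow_of_exponent_lt hlog (by linarith)
  have hpowpos : 0 < Real.log x ^ C' := Real.rpow_pos_of_pos hLpos C'
  have hlt' : x * (x / A) / Real.log x ^ (C' + 1) < x * (x / A) / Real.log x ^ C' :=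
    div_lt_div_of_pos_left hnum hpowpos hpow
  linarith

end Summit.Parity.GeneralizedHardyLittlewood.Theorems.TableChowla.HelsonKroneckerInverse
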